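import Summits.QuantumFields.YangMills.Theorems.UnitScaleTiltProp7TentInterpolation
import Summits.QuantumFields.YangMills.Theorems.UnitScaleTiltProp7BondAvgIterCoercivity
import Literature.MathematicalPhysics.QuantumFieldTheory.Balaban1983to89.TorusHypercubicSymmetry
import Literature.MathematicalPhysics.QuantumFieldTheory.Balaban1983to89.T4Covariance
import Literature.MathematicalPhysics.QuantumFieldTheory.Balaban1983to89.B4Eq19LatticeOperators
import HarnessLib

/-!
# Route `UnitScaleTilt`, crux K1 «MinimiserStabilityRegPr» (stmt-QuantumFields-19200), route-R E′ path (α′) — the sup-row residue (hK), brick (dict), part 1 of 2: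
# TORUS HESSIAN IDENTITY `Σ (Δf)² = Σ_{μν} Σ (∂_μ∂_νf)²`, THE PERIODIC LIFT `ℤ^d → T^{(0)}`, AND THE CENTRE LATTICE `≡ (L^k−1)∕2 (mod L^k)`

Cell `ym3-torus`, D-0154 (3c) twin-width seat `ym-routeR-w2` (gen 5).  THEOREMS ONLY (0 `def`, 0 `sorry`); `--supports stmt-QuantumFields-19200 --as helper`,
count-neutral.  YM₃ on T³ is a ladder rung (R3), not the Clay problem; nothing here claims the stub, the crux, d = 4 or the gap.

THE POINT.  The dictionary between the `ℤ^d` letters of lit `B4Eq19LatticeOperators` (`Zd d`, `fdiff`, `box`, `gradSq` — where the Morrey toolkit and the cell inequality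
✓ `Prop7VertexPinnedMorreyCell.sum_sq_le_hessian_of_vanish_vertices` live) and the flat torus letters of `LatticeFieldCalculus` (`Site P 0`, `pdiff c`, `laplace c`,
centres `embIter k`) in which the (α′) corrector rows (✓ `…CentreHarmonicRegaugeSup`, (D2′), (A)) are stated.  Part 2 (`…CentrePinnedHessianPoincare`) assembles the
global coercivity `c⁴·Σ v² ≤ C_G (L^k)⁴ Σ (Δv)²` from these letters.

WHAT IS PROVED (ns `…Theorems.Prop7TorusHessianLift`; real site functions on `Site P j` ∕ `Site P 0`).
* §1 (over ✓ `Site.shift_apply`∕`Site.shift_comm`∕`Site.shift_unshift`) `unshift_shift_comm`, `pdiff_comm`, `pdiff_pdiffAdj_comm`, `sum_pdiffAdj_pdiff_mul` (two summations by parts,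
  ✓ `LatticeFieldCalculus.sum_pdiff_mul`), ★ `sum_laplace_sq` — `Σ_x (laplace c f x)² = Σ_x Σ_μ Σ_ν (pdiff c μ (pdiff c ν f) x)²` (any level `j`, any `d`).
* §2 `cast_add_unitVec`, `fdiff_lift`, ★ `csq_fdiff_fdiff_lift` — for the lift `z ↦ v (μ ↦ (z_μ : ZMod |T^{(0)}|))`: `c²·∂_μ∂_ν(v∘π)(z) = (∂_μ∂_ν v)(π z)`.
* §3 (over ✓ `Prop7FlatCoercivity.sitesPerDir_zero_eq_pow_mul`) ★ `cast_mem_range_embIter` — a lattice point with all coordinates `≡ (L^k − 1)∕2 (mod L^k)` lifts into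
  `range (embIter k)` (✓ `Prop7TentInterpolation.val_embIter`).
HONEST SCOPE.  Folklore bookkeeping; no analysis.

References: T. Bałaban, CMP 95 (1984) 17–40 [Balaban1984PropagatorsI] ((1.21) p.21); CMP 109 (1987) 249–301 [Balaban1987RG1] ((0.1) p.251).
-/

set_option autoImplicit false

noncomputable section

open scoped BigOperators

namespace Summit.QuantumFields.YangMills.Theorems.Prop7TorusHessianLift

open Literature.MathematicalPhysics.QuantumFieldTheory.Balaban1983to89
open LatticeFieldCalculus
open B15DeterminingSets (embIter)
open B4Eq19LatticeOperators
open Summit.QuantumFields.YangMills.Theorems.Prop7TentInterpolation (val_embIter)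
open Summit.QuantumFields.YangMills.Theorems.Prop7FlatCoercivity (sitesPerDir_zero_eq_pow_mul)
open Finset

variable {P : Params}

/-! ## §1 Torus calculus: commuting differences and `Σ (Δf)² = Σ_{μν} Σ (∂_μ∂_ν f)²` -/

section Torus

variable {j : ℕ}

/-- translations commute: `(x + e_ν) − e_μ = (x − e_μ) + e_ν`. [folklore] -/
theorem unshift_shift_comm (x : Site P j) (μ ν : Fin P.d) : (x.shift ν).unshift μ = (x.unshift μ).shift ν := by
  by_cases h : μ = ν
  · subst h
    simp only [Site.shift, Site.unshift, Function.update_idem, Function.update_self]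
    congr 1; ring
  · simp only [Site.shift, Site.unshift, Function.update_of_ne (Ne.symm h), Function.update_of_ne h]
    exact (Function.update_comm (Ne.symm h) _ _ _)

/-- `∂_μ ∂_ν = ∂_ν ∂_μ`. [folklore] -/
theorem pdiff_comm (c : ℝ) (μ ν : Fin P.d) (f : SiteField P j ℝ) : pdiff c μ (pdiff c ν f) = pdiff c ν (pdiff c μ f) := by
  funext x
  simp only [pdiff, smul_eq_mul, Site.shift_comm x μ ν]
  ring

/-- `∂_ν ∂*_μ = ∂*_μ ∂_ν`. [folklore] -/
theorem pdiff_pdiffAdj_comm (c : ℝ) (μ ν : Fin P.d) (f : SiteField P j ℝ) : pdiff c ν (pdiffAdj c μ f) = pdiffAdj c μ (pdiff c ν f) := by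
  funext x
  simp only [pdiffAdj, pdiff, smul_eq_mul, unshift_shift_comm]
  ring

/-- the mixed term: `Σ_x (∂*_μ∂_μ f)(∂*_ν∂_ν f) = Σ_x (∂_μ∂_ν f)²` (two summations by parts, translations commute). [cite: Balaban1984PropagatorsI, (1.21) p.21] -/
theorem sum_pdiffAdj_pdiff_mul (c : ℝ) (μ ν : Fin P.d) (f : SiteField P j ℝ) :
    ∑ x : Site P j, pdiffAdj c μ (pdiff c μ f) x * pdiffAdj c ν (pdiff c ν f) x = ∑ x : Site P j, (pdiff c μ (pdiff c ν f) x) ^ 2 := by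
  have h1 := sum_pdiff_mul (P := P) (j := j) c μ (pdiffAdj c ν (pdiff c ν f)) (pdiff c μ f)
  -- `Σ (∂_μ h) g = Σ h (∂*_μ g)` with `h = ∂*_ν∂_ν f`, `g = ∂_μ f`
  have h2 : ∑ x : Site P j, pdiffAdj c μ (pdiff c μ f) x * pdiffAdj c ν (pdiff c ν f) x
      = ∑ x : Site P j, pdiff c μ (pdiffAdj c ν (pdiff c ν f)) x * pdiff c μ f x := by
    rw [h1]; exact Finset.sum_congr rfl fun x _ => by ring
  rw [h2, pdiff_pdiffAdj_comm]
  -- `Σ (∂*_ν W) g = Σ W (∂_ν g)`... via `sum_pdiff_mul` read backwards with `W = ∂_μ∂_ν f`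
  have h3 := sum_pdiff_mul (P := P) (j := j) c ν (pdiff c μ f) (pdiff c μ (pdiff c ν f))
  have h4 : ∑ x : Site P j, pdiffAdj c ν (pdiff c μ (pdiff c ν f)) x * pdiff c μ f x
      = ∑ x : Site P j, pdiff c ν (pdiff c μ f) x * pdiff c μ (pdiff c ν f) x := by
    rw [h3]; exact Finset.sum_congr rfl fun x _ => by ring
  rw [h4, pdiff_comm c ν μ f]
  exact Finset.sum_congr rfl fun x _ => by ring

/-- ★ **`Σ_x (Δf)(x)² = Σ_x Σ_μ Σ_ν (∂_μ∂_ν f)(x)²`** on the torus — the lattice Hessian energy IS the `ℓ²` norm of the Laplacian. [cite: Balaban1984PropagatorsI, (1.21) p.21] -/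
theorem sum_laplace_sq (c : ℝ) (f : SiteField P j ℝ) :
    ∑ x : Site P j, (laplace c f x) ^ 2 = ∑ x : Site P j, ∑ μ : Fin P.d, ∑ ν : Fin P.d, (pdiff c μ (pdiff c ν f) x) ^ 2 := by
  set A : Fin P.d → Site P j → ℝ := fun μ x => pdiffAdj c μ (pdiff c μ f) x with hA
  have h1 : ∀ x : Site P j, (laplace c f x) ^ 2 = ∑ μ : Fin P.d, ∑ ν : Fin P.d, A μ x * A ν x := by
    intro x
    rw [laplace_apply, sq, Finset.sum_mul_sum]
  have h2 : ∀ μ ν : Fin P.d, ∑ x : Site P j, A μ x * A ν x = ∑ x : Site P j, (pdiff c μ (pdiff c ν f) x) ^ 2 :=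
    fun μ ν => sum_pdiffAdj_pdiff_mul c μ ν f
  calc ∑ x : Site P j, (laplace c f x) ^ 2
      = ∑ x : Site P j, ∑ μ : Fin P.d, ∑ ν : Fin P.d, A μ x * A ν x := Finset.sum_congr rfl fun x _ => h1 x
    _ = ∑ μ : Fin P.d, ∑ x : Site P j, ∑ ν : Fin P.d, A μ x * A ν x := Finset.sum_comm
    _ = ∑ μ : Fin P.d, ∑ ν : Fin P.d, ∑ x : Site P j, A μ x * A ν x :=
        Finset.sum_congr rfl fun μ _ => Finset.sum_comm
    _ = ∑ μ : Fin P.d, ∑ ν : Fin P.d, ∑ x : Site P j, (pdiff c μ (pdiff c ν f) x) ^ 2 :=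
        Finset.sum_congr rfl fun μ _ => Finset.sum_congr rfl fun ν _ => h2 μ ν
    _ = ∑ μ : Fin P.d, ∑ x : Site P j, ∑ ν : Fin P.d, (pdiff c μ (pdiff c ν f) x) ^ 2 :=
        Finset.sum_congr rfl fun μ _ => Finset.sum_comm
    _ = ∑ x : Site P j, ∑ μ : Fin P.d, ∑ ν : Fin P.d, (pdiff c μ (pdiff c ν f) x) ^ 2 := Finset.sum_comm

end Torus

/-! ## §2 The periodic lift `ℤ^d → T^{(0)}` -/

/-- the lift of `z + e_ν` is the shift of the lift of `z`. [folklore] -/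
theorem cast_add_unitVec (z : Zd P.d) (ν : Fin P.d) :
    (fun μ => (((z + unitVec ν) μ : ℤ) : ZMod (P.sitesPerDir 0))) = Site.shift (fun μ => ((z μ : ℤ) : ZMod (P.sitesPerDir 0))) ν := by
  funext κ
  rw [Site.shift_apply]
  by_cases h : κ = ν
  · subst h; simp [unitVec]
  · simp [unitVec, h]

/-- forward differences of the lifted field are lifts of the torus differences: `∂_ν(v∘π)(z) = v(π z + e_ν) − v(π z)`. [folklore] -/
theorem fdiff_lift (v : SiteField P 0 ℝ) (ν : Fin P.d) (z : Zd P.d) :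
    fdiff ν (fun w : Zd P.d => v (fun μ => ((w μ : ℤ) : ZMod (P.sitesPerDir 0)))) z
      = v (Site.shift (fun μ => ((z μ : ℤ) : ZMod (P.sitesPerDir 0))) ν) - v (fun μ => ((z μ : ℤ) : ZMod (P.sitesPerDir 0))) := by
  rw [fdiff_apply, cast_add_unitVec]

/-- second differences: `c²·∂_μ∂_ν(v∘π)(z) = (∂_μ∂_ν v)(π z)` with the lattice factor `c` of `pdiff`. [folklore] -/
theorem csq_fdiff_fdiff_lift (c : ℝ) (v : SiteField P 0 ℝ) (μ ν : Fin P.d) (z : Zd P.d) :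
    c ^ 2 * fdiff μ (fdiff ν (fun w : Zd P.d => v (fun κ => ((w κ : ℤ) : ZMod (P.sitesPerDir 0))))) z
      = pdiff c μ (pdiff c ν v) (fun κ => ((z κ : ℤ) : ZMod (P.sitesPerDir 0))) := by
  rw [fdiff_apply, fdiff_lift, fdiff_lift, cast_add_unitVec]
  simp only [pdiff, smul_eq_mul]
  ring

/-! ## §3 The centre lattice: points `≡ (ℓ−1)∕2 (mod ℓ)` in every coordinate lift to `range (embIter k)` -/

/-- ★ a lattice point whose coordinates are all `≡ (L^k − 1)∕2 (mod L^k)` lifts to a `k`-centre. [cite: Balaban1987RG1, (0.1) p.251] -/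
theorem cast_mem_range_embIter {k : ℕ} (hk : k ≤ P.m + P.K) (z : Zd P.d)
    (hz : ∀ μ, ∃ q : ℤ, z μ = ((P.L ^ k - 1) / 2 : ℕ) + (P.L ^ k : ℤ) * q) :
    (fun μ => ((z μ : ℤ) : ZMod (P.sitesPerDir 0))) ∈ Set.range (embIter k) := by
  classical
  choose q hq using hz
  have hN : P.sitesPerDir 0 = P.L ^ k * P.sitesPerDir k := sitesPerDir_zero_eq_pow_mul hk
  refine ⟨fun μ => ((q μ : ℤ) : ZMod (P.sitesPerDir k)), ?_⟩
  funext μ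
  have hval := val_embIter hk (fun μ => ((q μ : ℤ) : ZMod (P.sitesPerDir k))) μ
  -- the label of the centre, as an integer cast
  have e1 : (embIter k (fun μ => ((q μ : ℤ) : ZMod (P.sitesPerDir k)))) μ
      = ((((((q μ : ℤ) : ZMod (P.sitesPerDir k))).val * P.L ^ k + (P.L ^ k - 1) / 2 : ℕ) : ℤ) : ZMod (P.sitesPerDir 0)) := by
    rw [Int.cast_natCast, ← hval, ZMod.natCast_zmod_val]
  rw [e1, hq μ, ZMod.intCast_eq_intCast_iff_dvd_sub]
  -- `|T^{(0)}| ∣ (c₀ + ℓq) − (val·ℓ + c₀) = ℓ·(q − val)` with `val ≡ q (mod |T^{(k)}|)`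
  have hv : (((((q μ : ℤ) : ZMod (P.sitesPerDir k))).val : ℕ) : ℤ) = q μ % (P.sitesPerDir k : ℤ) := ZMod.val_intCast (q μ)
  have hde : q μ % (P.sitesPerDir k : ℤ) + (P.sitesPerDir k : ℤ) * (q μ / (P.sitesPerDir k : ℤ)) = q μ := Int.emod_add_mul_ediv _ _
  refine ⟨q μ / (P.sitesPerDir k : ℤ), ?_⟩
  set c0 : ℕ := (P.L ^ k - 1) / 2 with hc0
  rw [hN]
  push_cast
  rw [hv]
  linear_combination (-((P.L : ℤ) ^ k)) * hde


end Summit.QuantumFields.YangMills.Theorems.Prop7TorusHessianLift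

end
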